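import Mathlib
import Summits.PneNP.PneNP.Theorems.PstarPDTUpper

/-!
# Affine `𝔽₂` path axioms and their polynomial-calculus bookkeeping (ROUND-24 pre-seed, item T24.3b, part I)

FRONTIER range-avoidance ladder, rung F-N3 (cell `pnp-ideate`; memo `HOME/pnp-ideate-p3/r24/ROUND-24-PRESEED.md` §6(3);
restricted-model proof complexity — nothing here bears on `P` vs `NP`).

Toolkit for `PstarPDTPolyCalc` (a parity decision tree solving `Search(I, y)` yields a `PC/𝔽₂` refutation of the fibre system
`fibrePolys I y` of degree `depth + 2`).  The induction over the tree carries the PATH of parity constraints answered so far; this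
file supplies

* generic `PC.DerivableInDegree` plumbing over any field: `derivable_zero_of`, `derivable_sum`, and MULTIPLYING A DERIVATION THROUGH
  by a fixed polynomial `h` (`derivable_mul_through`: a derivation from `𝓖` in degree `D` becomes a derivation of `f·h` from `𝓕` in
  degree `D'` once the images `g·h` of the axioms are supplied); the NODE STEP in characteristic `2` (`refutable_of_split`:
  refutations of `𝓖 ∪ {g}` and `𝓖 ∪ {g + 1}` in degree `D ≥ 2` give a refutation of `𝓖` in degree `D + 1`, provided `g (g+1)` is
  derivable — for a parity form `g = Σ_{v ∈ S} X_v` it is the sum of the Boolean axioms of `S`, `linPoly_mul_succ`);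
* the dictionary between the tree's `𝔽₂`-equations `LinEqMod 2 n` and affine polynomials (`affPolyL`, a linear map; its value at a
  Boolean point is the discrepancy `disc`, `eval_affPolyL`), the path constraints `(S, b)` ("`⊕_{v∈S} z_v = b`") as equations
  (`formOf`) and as axiom polynomials (`axOf (S, b) = Σ_{v∈S} X_v + b`), `pathAx`;
* AFFINE COMPLETENESS on a branch (`exists_cert`): if an affine equation `t` holds at every Boolean point of the branch cell of `P`,
  then for some `μ ∈ 𝔽₂` the polynomial `μ·affPoly t + (1 + μ)` is an `𝔽₂`-combination of the path axioms — the Fredholm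
  alternative `GaussianWidth.exists_lincomb_eq_zero_one` applied to `P ∪ {t + 1}` and pushed through `affPolyL`; it is delivered
  directly as a derivability transfer (every `k · axOf q`, `q ∈ P`, derivable ⇒ `k · (μ·affPoly t + 1 + μ)` derivable).
-/

set_option linter.dupNamespace false

open Finset MvPolynomial Literature.Computability.Complexity Literature.Computability.MetaComplexity
open Summit.PneNP.PneNP.Theorems.PstarFibrePolys (bit bit_xor bit_and bit_injective bit_add_bit_eq_zero_iff)

namespace Summit.PneNP.PneNP.Theorems.PstarPDT

/-! ## Generic polynomial-calculus plumbing -/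

section PC

variable {σ F : Type*} [Field F]

/-- `0` is derivable as soon as anything is (`f ⊢ f · 0`). -/
theorem derivable_zero_of {𝓕 : Set (MvPolynomial σ F)} {d : ℕ} {f : MvPolynomial σ F} (hf : PC.DerivableInDegree 𝓕 d f) :
    PC.DerivableInDegree 𝓕 d 0 := by
  simpa using hf.mul 0 (by simp)

/-- Finite sums of derivable polynomials are derivable. -/
theorem derivable_sum {𝓕 : Set (MvPolynomial σ F)} {d : ℕ} {ι : Type*} (s : Finset ι) (f : ι → MvPolynomial σ F)
    (h0 : PC.DerivableInDegree 𝓕 d 0) (h : ∀ i ∈ s, PC.DerivableInDegree 𝓕 d (f i)) :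
    PC.DerivableInDegree 𝓕 d (∑ i ∈ s, f i) :=
  Finset.sum_induction f (PC.DerivableInDegree 𝓕 d) (fun _ _ ha hb => ha.add hb) h0 h

/-- The Boolean axioms have degree `2`. -/
theorem totalDegree_boolAx_le (j : σ) : (X j ^ 2 - X j : MvPolynomial σ F).totalDegree ≤ 2 :=
  (totalDegree_sub _ _).trans (max_le (by rw [totalDegree_X_pow]) ((totalDegree_X (R := F) j).le.trans one_le_two))

/-- **Multiplying a derivation through.**  A degree-`D` derivation of `f` from `𝓖` becomes a degree-`D'` derivation of `f · h` from
`𝓕`, provided `D + deg h ≤ D'` and the images `g · h` of the axioms of `𝓖` (of degree `≤ D`) and of the Boolean axioms are derivable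
from `𝓕` in degree `D'` (line by line: `(f₁ + f₂) h = f₁ h + f₂ h`, `(f h') h = (f h) h'`). -/
theorem derivable_mul_through {𝓖 𝓕 : Set (MvPolynomial σ F)} {D D' : ℕ} (h : MvPolynomial σ F) (hD : D + h.totalDegree ≤ D')
    (hax : ∀ g ∈ 𝓖, g.totalDegree ≤ D → PC.DerivableInDegree 𝓕 D' (g * h))
    (hbool : ∀ j : σ, (X j ^ 2 - X j : MvPolynomial σ F).totalDegree ≤ D → PC.DerivableInDegree 𝓕 D' ((X j ^ 2 - X j) * h))
    {f : MvPolynomial σ F} (hf : PC.DerivableInDegree 𝓖 D f) : PC.DerivableInDegree 𝓕 D' (f * h) := by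
  induction hf with
  | hyp hg hd => exact hax _ hg hd
  | booleanAxiom j hd => exact hbool j hd
  | add _ _ ih₁ ih₂ =>
    rw [add_mul]
    exact ih₁.add ih₂
  | mul h' _ hd ih =>
    rw [mul_right_comm]
    refine ih.mul h' ?_
    rw [← mul_right_comm]
    exact (totalDegree_mul _ _).trans (by omega)

/-- **The node step in characteristic `2`.**  If `𝓖 ∪ {g}` and `𝓖 ∪ {g + 1}` are refutable in degree `D ≥ 2`, `deg g ≤ 1`, and
`g (g + 1)` is derivable from `𝓖`, then `𝓖` is refutable in degree `D + 1`: multiply the first refutation through by `g + 1` and the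
second by `g` (the axiom `g` becomes `g (g+1)`), obtaining `𝓖 ⊢ g + 1` and `𝓖 ⊢ g`, and add (`2g + 1 = 1`). -/
theorem refutable_of_split [CharP F 2] {𝓖 : Set (MvPolynomial σ F)} {D : ℕ} (hD : 2 ≤ D) (g : MvPolynomial σ F)
    (hg : g.totalDegree ≤ 1) (hgg : PC.DerivableInDegree 𝓖 (D + 1) (g * (g + 1)))
    (h₀ : PC.DerivableInDegree (𝓖 ∪ {g}) D 1) (h₁ : PC.DerivableInDegree (𝓖 ∪ {g + 1}) D 1) :
    PC.DerivableInDegree 𝓖 (D + 1) 1 := by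
  have hg1 : (g + 1).totalDegree ≤ 1 := (totalDegree_add _ _).trans (max_le hg (by simp))
  have hA : ∀ a k : MvPolynomial σ F, k.totalDegree ≤ 1 → PC.DerivableInDegree (𝓖 ∪ {a}) D 1 →
      PC.DerivableInDegree 𝓖 (D + 1) (a * k) → PC.DerivableInDegree 𝓖 (D + 1) k := by
    intro a k hk ha hak
    have key := derivable_mul_through (𝓖 := 𝓖 ∪ {a}) (𝓕 := 𝓖) (D := D) (D' := D + 1) k (by omega) ?_ ?_ ha
    · simpa using key
    · rintro g' (hg' | hg') hd
      · exact (PC.DerivableInDegree.hyp hg' (hd.trans (Nat.le_succ D))).mul k ((totalDegree_mul _ _).trans (by omega))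
      · rw [Set.mem_singleton_iff] at hg'
        subst hg'
        exact hak
    · intro j _
      have hb := totalDegree_boolAx_le (F := F) j
      exact (PC.DerivableInDegree.booleanAxiom j (hb.trans (by omega))).mul k ((totalDegree_mul _ _).trans (by omega))
  have e₁ : PC.DerivableInDegree 𝓖 (D + 1) (g + 1) := hA g (g + 1) hg1 h₀ hgg
  have e₀ : PC.DerivableInDegree 𝓖 (D + 1) g := hA (g + 1) g hg h₁ (by rw [mul_comm]; exact hgg)
  have := e₀.add e₁
  rwa [← add_assoc, CharTwo.add_self_eq_zero, zero_add] at this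

end PC

/-! ## Parity forms over `𝔽₂` as polynomials -/

variable {n : ℕ}

/-- Every element of `𝔽₂` is `0` or `1`. -/
private theorem zmod2_cases (a : ZMod 2) : a = 0 ∨ a = 1 := by
  revert a; decide

/-- The parity form `Σ_{v ∈ S} X_v ∈ 𝔽₂[X]`. -/
noncomputable def linPoly (S : Finset (Fin n)) : MvPolynomial (Fin n) (ZMod 2) := ∑ v ∈ S, X v

/-- Parity forms have degree `≤ 1`. -/
theorem totalDegree_linPoly_le (S : Finset (Fin n)) : (linPoly S).totalDegree ≤ 1 :=
  (totalDegree_finsetSum _ _).trans (Finset.sup_le fun v _ => (totalDegree_X (R := ZMod 2) v).le)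

/-- In characteristic `2`, `g (g + 1)` for a parity form `g` is the sum of the Boolean axioms of its variables. -/
theorem linPoly_mul_succ (S : Finset (Fin n)) : linPoly S * (linPoly S + 1) = ∑ v ∈ S, (X v ^ 2 - X v) := by
  rw [mul_add, mul_one, linPoly, CharTwo.sum_mul_self, ← sum_add_distrib]
  refine sum_congr rfl fun v _ => ?_
  rw [CharTwo.sub_eq_add, pow_two]

/-- Hence `g (g + 1)` is derivable (in any degree `≥ 2`) for a parity form `g`. -/
theorem derivable_linPoly_mul_succ {𝓖 : Set (MvPolynomial (Fin n) (ZMod 2))} {D : ℕ} (hD : 2 ≤ D)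
    (h0 : PC.DerivableInDegree 𝓖 D 0) (S : Finset (Fin n)) :
    PC.DerivableInDegree 𝓖 D (linPoly S * (linPoly S + 1)) := by
  rw [linPoly_mul_succ]
  exact derivable_sum S _ h0 fun v _ => PC.DerivableInDegree.booleanAxiom v ((totalDegree_boolAx_le v).trans hD)

/-! ## The affine dictionary `LinEqMod 2 n → 𝔽₂[X]` -/

/-- The affine polynomial `Σ_v E.1 v · X_v + E.2` of an `𝔽₂`-equation `E` (it vanishes at a Boolean point iff `E` holds there),
as an `𝔽₂`-linear map. -/
noncomputable def affPolyL : LinEqMod 2 n →ₗ[ZMod 2] MvPolynomial (Fin n) (ZMod 2) where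
  toFun E := ∑ v, E.1 v • X v + C E.2
  map_add' E E' := by
    simp only [Prod.fst_add, Prod.snd_add, Pi.add_apply, add_smul, sum_add_distrib, map_add]
    abel
  map_smul' c E := by
    simp only [Prod.smul_fst, Prod.smul_snd, Pi.smul_apply, smul_eq_mul, RingHom.id_apply, smul_add, Finset.smul_sum,
      smul_smul]
    congr 1
    rw [MvPolynomial.smul_eq_C_mul, ← map_mul]

/-- Unfolding `affPolyL`. -/
theorem affPolyL_apply (E : LinEqMod 2 n) : affPolyL E = ∑ v, E.1 v • X v + C E.2 := rfl

/-- At a Boolean point the affine polynomial of `E` evaluates to the discrepancy of `E`. -/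
theorem eval_affPolyL (E : LinEqMod 2 n) (z : Fin n → Bool) :
    MvPolynomial.eval (fun v => bit (z v)) (affPolyL E) = disc E z := by
  simp only [affPolyL_apply, disc, linVal, map_add, map_sum, smul_eval, eval_X, eval_C]

/-- Affine polynomials have degree `≤ 1`. -/
theorem totalDegree_affPolyL_le (E : LinEqMod 2 n) : (affPolyL E).totalDegree ≤ 1 := by
  rw [affPolyL_apply]
  refine (totalDegree_add _ _).trans (max_le ?_ ((totalDegree_C _).le.trans zero_le_one))
  refine (totalDegree_finsetSum _ _).trans (Finset.sup_le fun v _ => ?_)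
  exact (totalDegree_smul_le _ _).trans (totalDegree_X (R := ZMod 2) v).le

/-- The contradiction `0 = 1` is the polynomial `1`. -/
theorem affPolyL_zero_one : affPolyL ((0, 1) : LinEqMod 2 n) = 1 := by
  simp [affPolyL_apply]

/-! ## Path constraints -/

/-- The parity constraint `(S, b)` ("`⊕_{v ∈ S} z_v = b`") as an `𝔽₂`-equation. -/
def formOf (q : Finset (Fin n) × Bool) : LinEqMod 2 n := (fun v => if v ∈ q.1 then 1 else 0, bit q.2)

/-- Its support is the query set. -/
theorem supp_formOf (q : Finset (Fin n) × Bool) : (formOf q).supp = q.1 := by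
  ext v
  simp [formOf, LinEqMod.supp]

/-- The AXIOM POLYNOMIAL of the constraint `(S, b)`: `Σ_{v ∈ S} X_v + b`. -/
noncomputable def axOf (q : Finset (Fin n) × Bool) : MvPolynomial (Fin n) (ZMod 2) := linPoly q.1 + C (bit q.2)

/-- The dictionary sends the equation of a constraint to its axiom polynomial. -/
theorem affPolyL_formOf (q : Finset (Fin n) × Bool) : affPolyL (formOf q) = axOf q := by
  simp only [affPolyL_apply, formOf, axOf, linPoly, ite_smul, one_smul, zero_smul, sum_ite_mem, univ_inter]

/-- Axiom polynomials have degree `≤ 1`. -/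
theorem totalDegree_axOf_le (q : Finset (Fin n) × Bool) : (axOf q).totalDegree ≤ 1 := by
  rw [← affPolyL_formOf]
  exact totalDegree_affPolyL_le _

/-- The linear part of a constraint's equation at `z` is the queried parity. -/
theorem linVal_formOf (q : Finset (Fin n) × Bool) (z : Fin n → Bool) : linVal (formOf q) z = bit (parity q.1 z) :=
  linVal_of_parity (E := formOf q) (by rw [supp_formOf])

/-- The equation of `(S, b)` has zero discrepancy at `z` iff the parity of `z` on `S` is `b`. -/
theorem disc_formOf_eq_zero_iff (q : Finset (Fin n) × Bool) (z : Fin n → Bool) : disc (formOf q) z = 0 ↔ parity q.1 z = q.2 := by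
  rw [disc, linVal_formOf]
  exact bit_add_bit_eq_zero_iff _ _

/-- The axiom polynomials of a path. -/
def pathAx (P : List (Finset (Fin n) × Bool)) : Set (MvPolynomial (Fin n) (ZMod 2)) := {g | ∃ q ∈ P, axOf q = g}

/-- No axioms on the empty path. -/
theorem pathAx_nil : pathAx ([] : List (Finset (Fin n) × Bool)) = ∅ := by
  ext g
  simp [pathAx]

/-- The axioms of an extended path. -/
theorem pathAx_cons (q : Finset (Fin n) × Bool) (P : List (Finset (Fin n) × Bool)) :
    pathAx (q :: P) = insert (axOf q) (pathAx P) := by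
  ext g
  simp only [pathAx, List.mem_cons, Set.mem_setOf_eq, Set.mem_insert_iff]
  constructor
  · rintro ⟨q', rfl | hq', rfl⟩
    · exact Or.inl rfl
    · exact Or.inr ⟨q', hq', rfl⟩
  · rintro (rfl | ⟨q', hq', rfl⟩)
    · exact ⟨q, Or.inl rfl, rfl⟩
    · exact ⟨q', Or.inr hq', rfl⟩

/-- Membership in `pathAx`. -/
theorem axOf_mem_pathAx {q : Finset (Fin n) × Bool} {P : List (Finset (Fin n) × Bool)} (h : q ∈ P) : axOf q ∈ pathAx P :=
  ⟨q, h, rfl⟩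

/-! ## Affine completeness on a branch -/

/-- **Affine completeness on a branch cell.**  If the `𝔽₂`-equation `t` holds at every Boolean point of the cell of the path `P`,
(the CELL of `P`: the inputs `z` answering every recorded query as recorded, `∀ q ∈ P, parity q.1 z = q.2`), then for some
`μ ∈ 𝔽₂` the polynomial `μ · affPoly t + (1 + μ)` is an `𝔽₂`-combination `Σ_q c_q · axOf q` of the path axioms
(`μ = 1`: `affPoly t` itself; `μ = 0`: the cell is empty and `1` is such a combination) — delivered as a transfer of derivability:
whenever every `k · axOf q` (`q ∈ P`) is derivable, so is `k · (μ · affPoly t + (1 + μ))`.  [The Fredholm alternative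
`exists_lincomb_eq_zero_one` for the system `P ∪ {t + 1}`, pushed through the linear map `affPolyL`.] -/
theorem exists_cert (P : List (Finset (Fin n) × Bool)) (t : LinEqMod 2 n)
    (himp : ∀ z : Fin n → Bool, (∀ q ∈ P, parity q.1 z = q.2) → disc t z = 0) :
    ∃ μ : ZMod 2, ∀ (𝓖 : Set (MvPolynomial (Fin n) (ZMod 2))) (D : ℕ) (k : MvPolynomial (Fin n) (ZMod 2)),
      PC.DerivableInDegree 𝓖 D 0 → (∀ q ∈ P, PC.DerivableInDegree 𝓖 D (k * axOf q)) →
      PC.DerivableInDegree 𝓖 D (k * (μ • affPolyL t + C (1 + μ))) := by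
  -- the system: the negated target first, then the path rows
  set t' : LinEqMod 2 n := (t.1, t.2 + 1) with ht'
  set rows : Fin (P.length + 1) → LinEqMod 2 n := Fin.cons t' fun i => formOf (P.get i) with hrows
  have hunsat : ¬ SystemSat rows univ := by
    rintro ⟨x, hx⟩
    set z : Fin n → Bool := fun v => decide (x v = 1) with hzdef
    have hbz : ∀ v, bit (z v) = x v := by
      intro v
      rcases zmod2_cases (x v) with h | h <;> simp [hzdef, h, bit]
    have hxz : x = fun v => bit (z v) := funext fun v => (hbz v).symm
    have hP : ∀ q ∈ P, parity q.1 z = q.2 := by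
      intro q hq
      obtain ⟨i, hi⟩ := List.get_of_mem hq
      have h1 := hx (Fin.succ i) (mem_univ _)
      simp only [hrows, Fin.cons_succ, hi] at h1
      rw [← disc_formOf_eq_zero_iff]
      have h2 : linVal (formOf q) z = (formOf q).2 := by rw [hxz] at h1; exact h1
      rw [disc, h2]
      exact CharTwo.add_self_eq_zero _
    have h0 := hx 0 (mem_univ _)
    simp only [hrows, Fin.cons_zero] at h0
    have h3 : linVal t z = t.2 + 1 := by rw [hxz] at h0; exact h0
    have h4 := himp z hP
    rw [disc, h3] at h4
    rcases zmod2_cases t.2 with e | e <;> rw [e] at h4 <;> exact absurd h4 (by decide)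
  obtain ⟨c', hc'⟩ := exists_lincomb_eq_zero_one rows hunsat
  have hpoly := congrArg affPolyL hc'
  rw [lincomb_eq_sum, map_sum, affPolyL_zero_one, Fin.sum_univ_succ] at hpoly
  simp only [map_smul, hrows, Fin.cons_zero, Fin.cons_succ, affPolyL_formOf] at hpoly
  have ht'poly : affPolyL t' = affPolyL t + 1 := by
    simp only [affPolyL_apply, ht', map_add, map_one]
    abel
  rw [ht'poly] at hpoly
  -- hpoly : c' 0 • (affPolyL t + 1) + Σ i, c' i.succ • axOf (P.get i) = 1
  have hsum : ∑ i, c' i.succ • axOf (P.get i) = c' 0 • affPolyL t + C (1 + c' 0) := by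
    have e1 : ∑ i, c' i.succ • axOf (P.get i) = 1 - c' 0 • (affPolyL t + 1) := eq_sub_of_add_eq' hpoly
    rw [e1, CharTwo.sub_eq_add, smul_add, map_add, map_one, MvPolynomial.smul_eq_C_mul, MvPolynomial.smul_eq_C_mul, mul_one]
    ring
  refine ⟨c' 0, fun 𝓖 D k h0 hq => ?_⟩
  rw [← hsum, mul_sum]
  refine derivable_sum _ _ h0 fun i _ => ?_
  rw [mul_smul_comm]
  exact (hq _ (List.get_mem P i)).smul _

end Summit.PneNP.PneNP.Theorems.PstarPDT
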